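import Mathlib
import Summits.Ventures.PercRepro2.Defs
import Summits.Ventures.PercRepro2.Graph
import Summits.Ventures.PercRepro2.HullDefs
import Summits.Ventures.PercRepro2.Switching
import Summits.Ventures.PercRepro2.LastVertex
import Summits.Ventures.PercRepro2.ReimerIncreasing
import Summits.Ventures.PercRepro2.ReimerDecreasing
import Summits.Ventures.PercRepro2.TwoClusterBK
import Summits.Ventures.PercRepro2.OneSidedBase

/-!
# The rigid one-sided permutation (blind cell PercRepro2, night-4 g5, 2026-08-24;
proofs/NIGHT4-BRIDGE.md §11, statement (RO))

On the class `{o ∈ C_R(u), h ∉ C_R(u)}` there is a permutation under which EVERY red edge inside the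
red cluster of `h` becomes blue.  The red witnesses of `o ∈ C_R(u)` (the `u`-component of the red
set) and of `red_in(C_R(h)) ∈ 𝓕` (the `h`-component, which IS `red_in(C_R(h))`) are disjoint on
`{h ∉ C_R(u)}`, so the Reimer inequality on a decreasing set (`ReimerCube.reimer_decreasing`)
gives, for every up-set `𝓕` of edge sets,
`#{o ∈ C_R(u), h ∉ C_R(u), red_in(C_R(h)) ∈ 𝓕} ≤ #{o ∈ C_R(u), h ∉ C_R(u), blue ∈ 𝓕}`
(`card_rigid_oneSided_le`), and Hall's theorem turns the family of these inequalities into the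
permutation (`exists_rigidOneSided`).  This is the tool of the rigid block placement `l ∣ {h, o}`
of row 2′SW-ALL (`LocRows.SwAll`).
-/

namespace Summit.Ventures.PercRepro2

namespace RigidOS

open Hull ReimerCube OneSided

open scoped Classical

variable {V : Type*} {E : Type*} [Fintype E] [DecidableEq E] (ends : E → Sym2 V)

/-- The blue edges of a configuration. -/
def blueF (ζ : Config E) : Finset E := Finset.univ.filter fun e => ζ e = false

omit [DecidableEq E] in
/-- Membership in `blueF`. -/
lemma mem_blueF {ζ : Config E} {e : E} : e ∈ blueF ζ ↔ ζ e = false := by simp [blueF]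

/-- The red edges inside the red cluster of `h`: the `h`-component of the red set. -/
noncomputable def hRed (h : V) (ζ : Config E) : Finset E := sComp ends (toFinset ζ) h

/-- A red edge inside the red cluster of `h` is in `hRed`. -/
lemma mem_hRed_of {h : V} {ζ : Config E} {e : E} (he : e ∈ within ends (cluster ends ζ h))
    (hred : ζ e = true) : e ∈ hRed ends h ζ := by
  obtain ⟨x, hx, _, _, hends⟩ := he
  rw [hRed, sComp, Finset.mem_filter]
  refine ⟨by simp [toFinset, hred], x, by rw [hends]; exact Sym2.mem_mk_left _ _, ?_⟩
  show Conn ends (ofFinset (toFinset ζ)) h x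
  rw [ofFinset_toFinset]; exact hx

omit [Fintype E] in
/-- The `h`-component of `S` is contained in the `h`-component of every `T` containing it. -/
lemma sComp_mono_of_subset (h : V) {S T : Finset E} (hT : sComp ends S h ⊆ T) :
    sComp ends S h ⊆ sComp ends T h := by
  intro e he
  have heT := hT he
  rw [sComp, Finset.mem_filter] at he ⊢
  obtain ⟨_, x, hx, hsx⟩ := he
  exact ⟨heT, x, hx, (carries_sComp hsx).mono hT⟩

/-- The event `{red_in(C_R(h)) ∈ 𝓕}` on the cube. -/
def evR (h : V) (𝓕 : Set (Finset E)) (S : Finset E) : Prop := sComp ends S h ∈ 𝓕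

omit [Fintype E] in
/-- `{red_in(C_R(h)) ∈ 𝓕}` is increasing for an up-set `𝓕`. -/
lemma incr_evR (h : V) {𝓕 : Set (Finset E)} (h𝓕 : IsUpperSet 𝓕) : Incr (evR ends h 𝓕) :=
  fun S _ hST hS => h𝓕 (sComp_mono_of_subset ends h ((sComp_subset ends S h).trans hST)) hS

omit [Fintype E] in
/-- `{u ↔ o}` is increasing. -/
lemma incr_carries (u o : V) : Incr (fun S : Finset E => Carries ends S u o) :=
  fun _ _ hST hS => hS.mono hST

/-- The event `{u ↮ h}` on the cube. -/
def evD (u h : V) (S : Finset E) : Prop := ¬ Carries ends S u h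

omit [Fintype E] in
/-- `{u ↮ h}` is decreasing. -/
lemma decr_evD (u h : V) : Decr (evD ends u h) :=
  fun _ _ hST hT hS => hT (hS.mono hST)

/-- **Rigid one-sided domination, cube form**: for every up-set `𝓕`,
`#{o ∈ C_R(u), red_in(C_R(h)) ∈ 𝓕, h ∉ C_R(u)} ≤ #{o ∈ C_R(u), blue ∈ 𝓕, h ∉ C_R(u)}`. -/
theorem count_le_rigid (u h o : V) {𝓕 : Set (Finset E)} (h𝓕 : IsUpperSet 𝓕) :
    (Finset.univ.powerset.filter fun S : Finset E =>
        Carries ends S u o ∧ sComp ends S h ∈ 𝓕 ∧ ¬ Carries ends S u h).card ≤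
      (Finset.univ.powerset.filter fun S : Finset E =>
        Carries ends S u o ∧ blueF (ofFinset S) ∈ 𝓕 ∧ ¬ Carries ends S u h).card := by
  calc (Finset.univ.powerset.filter fun S : Finset E =>
        Carries ends S u o ∧ sComp ends S h ∈ 𝓕 ∧ ¬ Carries ends S u h).card
      ≤ (Finset.univ.powerset.filter fun S : Finset E =>
          DOcc (fun S => Carries ends S u o) (evR ends h 𝓕) S ∧ evD ends u h S).card := by
        apply Finset.card_le_card
        intro S hS
        simp only [Finset.mem_filter, Finset.mem_powerset] at hS ⊢
        obtain ⟨hSU, hAS, hJS, hDS⟩ := hS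
        refine ⟨hSU, ⟨sComp ends S u, sComp ends S h, sComp_subset ends S u, sComp_subset ends S h,
          disjoint_sComp_of_not_carries hDS, ?_, ?_⟩, hDS⟩
        · intro T hT
          exact (carries_sComp hAS).mono hT
        · intro T hT
          exact h𝓕 (sComp_mono_of_subset ends h hT) hJS
    _ ≤ (Finset.univ.powerset.filter fun S : Finset E =>
          Carries ends S u o ∧ evR ends h 𝓕 (Finset.univ \ S) ∧ evD ends u h S).card :=
        reimer_decreasing Finset.univ (fun S => Carries ends S u o) (evR ends h 𝓕) (evD ends u h)
          (incr_carries ends u o) (incr_evR ends h h𝓕) (decr_evD ends u h)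
    _ ≤ _ := by
        apply Finset.card_le_card
        intro S hS
        simp only [Finset.mem_filter, Finset.mem_powerset, evR, evD] at hS ⊢
        obtain ⟨hSU, hAS, hJS, hDS⟩ := hS
        refine ⟨hSU, hAS, h𝓕 ?_ hJS, hDS⟩
        intro e he
        have := Finset.mem_sdiff.1 (sComp_subset ends _ h he)
        rw [mem_blueF, ofFinset_apply]
        simp [this.2]

/-- The class `{o ∈ C_R(u), h ∉ C_R(u)}`. -/
noncomputable def osClass (u h o : V) : Finset (Config E) :=
  Finset.univ.filter fun ζ => o ∈ cluster ends ζ u ∧ h ∉ cluster ends ζ u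

/-- **Rigid one-sided domination**: for every up-set `𝓕` of edge sets,
`#{ζ ∈ osClass : red_in(C_R(h)) ∈ 𝓕} ≤ #{ζ ∈ osClass : blue ζ ∈ 𝓕}`. -/
theorem card_rigid_oneSided_le (u h o : V) {𝓕 : Set (Finset E)} (h𝓕 : IsUpperSet 𝓕) :
    ((osClass ends u h o).filter fun ζ => hRed ends h ζ ∈ 𝓕).card ≤
      ((osClass ends u h o).filter fun ζ => blueF ζ ∈ 𝓕).card := by
  rw [osClass, Finset.filter_filter, Finset.filter_filter, card_filter_eq_card_powerset_filter,
    card_filter_eq_card_powerset_filter]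
  have key := count_le_rigid ends u h o h𝓕
  refine le_of_le_of_eq (le_of_eq_of_le ?_ key) ?_
  · congr 1; ext S
    simp only [Finset.mem_filter, Finset.mem_powerset, mem_cluster, Carries, hRed, toFinset_ofFinset]
    tauto
  · congr 1; ext S
    simp only [Finset.mem_filter, Finset.mem_powerset, mem_cluster, Carries]
    tauto

/-- **The rigid one-sided permutation** (Hall): an injection of `{o ∈ C_R(u), h ∉ C_R(u)}` into
itself under which every red edge inside the red cluster of `h` is blue in the image. -/
theorem exists_rigidOneSided (u h o : V) :
    ∃ f : {ζ // ζ ∈ osClass ends u h o} → Config E, Function.Injective f ∧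
      ∀ x, f x ∈ osClass ends u h o ∧
        ∀ e, e ∈ within ends (cluster ends x.1 h) → x.1 e = true → f x e = false := by
  let D := osClass ends u h o
  let R : Config E → Finset E := hRed ends h
  let t : {ζ // ζ ∈ D} → Finset (Config E) := fun x => D.filter fun η => ∀ e ∈ R x.1, η e = false
  have hall : ∀ s : Finset {ζ // ζ ∈ D}, s.card ≤ (s.biUnion t).card := by
    intro s
    obtain ⟨𝓕, h𝓕, h𝓕mem⟩ : ∃ 𝓕 : Set (Finset E), IsUpperSet 𝓕 ∧ ∀ F, F ∈ 𝓕 ↔ ∃ x ∈ s, R x.1 ⊆ F :=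
      ⟨{F | ∃ x ∈ s, R x.1 ⊆ F}, fun F F' hFF' ⟨x, hx, hxF⟩ => ⟨x, hx, hxF.trans hFF'⟩,
        fun F => Iff.rfl⟩
    have e1 : s.biUnion t = D.filter fun η => blueF η ∈ 𝓕 := by
      ext η
      simp only [Finset.mem_biUnion, Finset.mem_filter, t, h𝓕mem]
      constructor
      · rintro ⟨x, hx, hη, hsub⟩
        exact ⟨hη, x, hx, fun e he => mem_blueF.2 (hsub e he)⟩
      · rintro ⟨hη, x, hx, hsub⟩
        exact ⟨x, hx, hη, fun e he => mem_blueF.1 (hsub he)⟩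
    have e2 : s.card ≤ (D.filter fun ζ => R ζ ∈ 𝓕).card := by
      refine Finset.card_le_card_of_injOn (fun x => x.1) ?_ ?_
      · intro x hx
        rw [Finset.mem_coe] at hx
        simp only [Finset.mem_coe, Finset.mem_filter, h𝓕mem]
        exact ⟨x.2, x, hx, le_rfl⟩
      · intro x _ y _ hxy
        exact Subtype.ext hxy
    calc s.card ≤ (D.filter fun ζ => R ζ ∈ 𝓕).card := e2
      _ ≤ (D.filter fun ζ => blueF ζ ∈ 𝓕).card := card_rigid_oneSided_le ends u h o h𝓕
      _ = (s.biUnion t).card := by rw [e1]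
  obtain ⟨f, hf, hft⟩ := (Finset.all_card_le_biUnion_card_iff_exists_injective t).1 hall
  refine ⟨f, hf, fun x => ?_⟩
  have := hft x
  simp only [t, Finset.mem_filter] at this
  exact ⟨this.1, fun e he hred => this.2 e (mem_hRed_of ends he hred)⟩

end RigidOS

end Summit.Ventures.PercRepro2
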